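import Literature.NumberTheory.Sieve.GoldstonPintzYildirimThetaDirichlet
import Literature.NumberTheory.Sieve.GoldstonPintzYildirimPairPerron
import HarnessLib

/-!
# Goldston–Pintz–Yıldırım, *Primes in tuples I*, §9 (9.15): `𝒯̃_R` as a double line integral

Trunk: NumberTheory / Sieve. GPY, *Primes in tuples. I* (Ann. of Math. 170 (2009) =
arXiv:math/0508185), §9, p. 19, (9.15): "Returning to the main term in (9.12), we have by (6.6) that

  `𝒯̃_R(H₁,H₂,ℓ₁,ℓ₂,h₀) = (2πi)⁻² ∫_(1)∫_(1) F(s₁,s₂) R^{s₁}s₁^{−(k₁+ℓ₁+1)} R^{s₂}s₂^{−(k₂+ℓ₂+1)} ds₁ds₂`,"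

with `F` the series (9.16) (`FDir₂Star` of `GoldstonPintzYildirimThetaDirichlet`) and
`𝒯̃_R = mainTRTheta` ((9.12), `GoldstonPintzYildirimTheta`). Everything here is PROVED (theorems
only), by instantiating the generic double Perron identity of `GoldstonPintzYildirimPairPerron` at
the coefficients `pairCoeffStar`:

* `integral_integral_FDir₂Star_mul_perronPow` — (9.15) in parametrised form (`sⱼ = 1 + itⱼ`,
  both `Hᵢ` nonempty so that `kᵢ + ℓᵢ ≥ 1`): `∫∫ F · R^{s₁}s₁^{−(A+1)} R^{s₂}s₂^{−(B+1)} = (2π)² 𝒯̃_R`;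
* `mainTRTheta_eq_integral_integral` — **(9.15)** as printed.

## References

* D. A. Goldston, J. Pintz, C. Y. Yıldırım, *Primes in tuples. I*, Ann. of Math. (2) 170 (2009),
  819–862 = arXiv:math/0508185, §9 (9.15), p. 19. [cite: GoldstonPintzYildirim2009]
-/

noncomputable section

open Finset MeasureTheory Complex Literature.Analysis.Complex

namespace Literature.NumberTheory.Sieve.GPY

/-- **GPY (9.15)** (parametrised form, iterated integral with `t₁` inside): for `H₁, H₂` nonempty,
`R > 0`, `A = k₁ + ℓ₁`, `B = k₂ + ℓ₂`, `sⱼ = 1 + itⱼ`,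
`∫∫ F(s₁,s₂) R^{s₁}s₁^{−(A+1)} R^{s₂}s₂^{−(B+1)} dt₁ dt₂ = (2π)² 𝒯̃_R(H₁,H₂,ℓ₁,ℓ₂,h₀)`.
[cite: GoldstonPintzYildirim2009, Section 9 eq. 9.15] -/
theorem integral_integral_FDir₂Star_mul_perronPow {R : ℝ} (hR : 0 < R) (h₀ : ℕ) {H₁ H₂ : Finset ℕ}
    (h₁ : H₁.Nonempty) (h₂ : H₂.Nonempty) (ℓ₁ ℓ₂ : ℕ) :
    ∫ t₂ : ℝ, ∫ t₁ : ℝ, FDir₂Star h₀ H₁ H₂ (((1 : ℝ) : ℂ) + t₁ * I) (((1 : ℝ) : ℂ) + t₂ * I) *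
        perronPow R (#H₁ + ℓ₁) (((1 : ℝ) : ℂ) + t₁ * I) *
          perronPow R (#H₂ + ℓ₂) (((1 : ℝ) : ℂ) + t₂ * I) =
      (2 * Real.pi) ^ 2 * (mainTRTheta R H₁ H₂ ℓ₁ ℓ₂ h₀ : ℂ) := by
  have hk : 1 ≤ #H₁ + #H₂ := le_add_right h₁.card_pos
  have hA : 1 ≤ #H₁ + ℓ₁ := le_add_right h₁.card_pos
  have hB : 1 ≤ #H₂ + ℓ₂ := le_add_right h₂.card_pos
  have h := integral_integral_tsum_mul_perronPow (c := pairCoeffStar h₀ H₁ H₂)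
    (pairCoeffStar_zero_left h₀ H₁ H₂) (pairCoeffStar_zero_right h₀ H₁ H₂)
    (summable_abs_pairCoeffStar_div h₀ H₁ H₂ hk) hR hA hB
  have hF : ∀ t₁ t₂ : ℝ, FDir₂Star h₀ H₁ H₂ (((1 : ℝ) : ℂ) + t₁ * I) (((1 : ℝ) : ℂ) + t₂ * I) =
      ∑' p : ℕ × ℕ, (pairCoeffStar h₀ H₁ H₂ p.1 p.2 : ℂ) /
        ((p.1 : ℂ) ^ (((1 : ℝ) : ℂ) + t₁ * I) * (p.2 : ℂ) ^ (((1 : ℝ) : ℂ) + t₂ * I)) :=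
    fun _ _ => rfl
  simp_rw [hF]
  rw [h, mainTRTheta]
  push_cast
  congr 1
  rw [Finset.mul_sum]
  refine Finset.sum_congr rfl fun p _ => ?_
  simp only [pairCoeffStar]
  push_cast
  ring

/-- **GPY (9.15)** as printed: `𝒯̃_R = (2πi)⁻² ∫_(1)∫_(1) F(s₁,s₂) R^{s₁}s₁^{−(k₁+ℓ₁+1)} R^{s₂}s₂^{−(k₂+ℓ₂+1)} ds₁ds₂`,
i.e. with `sⱼ = 1 + itⱼ`: `𝒯̃_R = (2π)⁻² ∫ (∫ … dt₁) dt₂` (both `Hᵢ` nonempty, `R > 0`).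
[cite: GoldstonPintzYildirim2009, Section 9 eq. 9.15] -/
theorem mainTRTheta_eq_integral_integral {R : ℝ} (hR : 0 < R) (h₀ : ℕ) {H₁ H₂ : Finset ℕ}
    (h₁ : H₁.Nonempty) (h₂ : H₂.Nonempty) (ℓ₁ ℓ₂ : ℕ) :
    (mainTRTheta R H₁ H₂ ℓ₁ ℓ₂ h₀ : ℂ) = (1 / (2 * Real.pi) ^ 2 : ℂ) *
      ∫ t₂ : ℝ, ∫ t₁ : ℝ, FDir₂Star h₀ H₁ H₂ (((1 : ℝ) : ℂ) + t₁ * I) (((1 : ℝ) : ℂ) + t₂ * I) *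
        perronPow R (#H₁ + ℓ₁) (((1 : ℝ) : ℂ) + t₁ * I) *
          perronPow R (#H₂ + ℓ₂) (((1 : ℝ) : ℂ) + t₂ * I) := by
  rw [integral_integral_FDir₂Star_mul_perronPow hR h₀ h₁ h₂ ℓ₁ ℓ₂]
  have hπ : ((2 * Real.pi) ^ 2 : ℂ) ≠ 0 := by
    exact_mod_cast (pow_pos (mul_pos two_pos Real.pi_pos) 2).ne'
  field_simp

/-! ### One of `H₁, H₂` empty: the dummy second variable

When `H₂ = ∅` (so `ℓ₂ = 0`, `Λ_R(n; ∅, 0) = 1`) the coefficient `c*(d,e)` vanishes unless `e = 1`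
(`ν*_p(∅⁰) = ν_p({h₀}) − 1 = 0` and `ν̄*_p((H₁ ∩̄ ∅)⁰) = 0`), the series `F(s₁,s₂)` does not depend on
`s₂`, and `𝒯̃_R` is a single sum. GPY treat this case "by an argument analogous to that of
Section 6" (§9, first paragraph of the proof). To stay inside the two-variable Lemma 3 (whose
hypothesis `b + v ≥ 1` excludes `b = v = 0`) we insert the absolutely convergent dummy kernel
`R^{s₂}s₂^{−2}` (`v = 1`), whose line integral is `2π log R` ((6.6) with `k = 1`): -/

/-- For `H₂ = ∅` and squarefree `e ≥ 2`, `d ≥ 1`: `nuJointStar(d, e) = 0` (at a prime `p ∣ e` the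
local factor is `ν*_p(∅⁰) = 0` or `ν̄*_p((H₁ ∩̄ ∅)⁰) = 0`).
[cite: GoldstonPintzYildirim2009, Section 9 eq. 9.11] -/
theorem nuJointStar_empty_right_eq_zero (h₀ : ℕ) (H₁ : Finset ℕ) {d e : ℕ} (hd : d ≠ 0)
    (hsq : Squarefree e) (he : 2 ≤ e) : nuJointStar h₀ H₁ ∅ d e = 0 := by
  obtain ⟨p, hp, hpe⟩ := Nat.exists_prime_and_dvd (by omega : e ≠ 1)
  unfold nuJointStar
  apply Finset.prod_eq_zero (i := p)
  · exact Nat.mem_primeFactors.2 ⟨hp, hpe.trans (Nat.dvd_lcm_right d e),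
      Nat.lcm_ne_zero hd hsq.ne_zero⟩
  · unfold nuJointStarPrime
    have h0 : nuStarPrime h₀ (∅ : Finset ℕ) p = 0 := by
      simp [nuStarPrime, nuPrime]
    have h1 : nuBarStar h₀ H₁ ∅ p = 0 := by
      rw [nuBarStar, nuBar_eq_card_inter]
      have himg : (insert h₀ (∅ : Finset ℕ)).image (fun h => h % p) = {h₀ % p} := by simp
      rw [himg]
      have hle : #((insert h₀ H₁).image (fun h => h % p) ∩ {h₀ % p}) ≤ 1 :=
        (Finset.card_le_card Finset.inter_subset_right).trans (by simp)
      omega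
    by_cases hpd : p ∣ d
    · rw [if_pos hpd, if_pos hpe, h1]
    · rw [if_neg hpd, h0]

/-- For `H₂ = ∅`: `𝒯̃_R(H₁, ∅, ℓ₁, 0, h₀) · log R = ∑_{1 ≤ d,e ≤ R} c*(d,e) (log R/d)^A/A! · (log R/e)/1!`
(only `e = 1` contributes on either side). [cite: GoldstonPintzYildirim2009, Section 9 eq. 9.12] -/
theorem mainTRTheta_empty_mul_log (R : ℝ) (h₀ : ℕ) (H₁ : Finset ℕ) (ℓ₁ : ℕ) :
    mainTRTheta R H₁ ∅ ℓ₁ 0 h₀ * Real.log R =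
      ∑ de ∈ Icc 1 ⌊R⌋₊ ×ˢ Icc 1 ⌊R⌋₊, pairCoeffStar h₀ H₁ ∅ de.1 de.2 *
        (Real.log (R / de.1) ^ (#H₁ + ℓ₁) / ((#H₁ + ℓ₁).factorial : ℝ) *
          (Real.log (R / de.2) ^ 1 / ((1 : ℕ).factorial : ℝ))) := by
  rw [mainTRTheta, Finset.card_empty, Finset.mul_sum, Finset.sum_mul]
  refine Finset.sum_congr rfl fun de hde => ?_
  obtain ⟨d, e⟩ := de
  obtain ⟨hd, he⟩ := Finset.mem_product.1 hde
  have hd1 : 1 ≤ d := (Finset.mem_Icc.1 hd).1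
  have he1 : 1 ≤ e := (Finset.mem_Icc.1 he).1
  dsimp only
  rcases Nat.eq_or_lt_of_le he1 with he1' | he2
  · subst he1'
    simp only [pairCoeffStar, Nat.cast_one, div_one, pow_one, zero_add, pow_zero, Nat.factorial_zero,
      Nat.factorial_one, Nat.cast_one, inv_one, mul_one]
    ring
  · have he2' : 2 ≤ e := he2
    by_cases hsq : Squarefree e
    · simp [pairCoeffStar, nuJointStar_empty_right_eq_zero h₀ H₁ (by omega : d ≠ 0) hsq he2']
    · simp [pairCoeffStar, ArithmeticFunction.moebius_eq_zero_of_not_squarefree hsq]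

/-- **(9.15) with a dummy second variable, `H₂ = ∅`**: for `H₁` nonempty, `R > 0`,
`A = k₁ + ℓ₁`, `sⱼ = 1 + itⱼ`,
`∫∫ F(s₁,s₂) R^{s₁}s₁^{−(A+1)} R^{s₂}s₂^{−2} dt₁ dt₂ = (2π)² 𝒯̃_R(H₁,∅,ℓ₁,0,h₀) · log R`
(only `e = 1` contributes; `∫ R^{s₂}s₂^{−2} = 2π log R` for `R ≥ 1`, and both sides vanish termwise
consistently for `R < 1`). [cite: GoldstonPintzYildirim2009, Section 9 eq. 9.15] -/
theorem integral_integral_FDir₂Star_mul_perronPow_empty {R : ℝ} (hR : 0 < R) (h₀ : ℕ) {H₁ : Finset ℕ}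
    (h₁ : H₁.Nonempty) (ℓ₁ : ℕ) :
    ∫ t₂ : ℝ, ∫ t₁ : ℝ, FDir₂Star h₀ H₁ ∅ (((1 : ℝ) : ℂ) + t₁ * I) (((1 : ℝ) : ℂ) + t₂ * I) *
        perronPow R (#H₁ + ℓ₁) (((1 : ℝ) : ℂ) + t₁ * I) * perronPow R 1 (((1 : ℝ) : ℂ) + t₂ * I) =
      (2 * Real.pi) ^ 2 * ((mainTRTheta R H₁ ∅ ℓ₁ 0 h₀ : ℂ) * (Real.log R : ℂ)) := by
  have hk : 1 ≤ #H₁ + #(∅ : Finset ℕ) := by simpa using h₁.card_pos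
  have hA : 1 ≤ #H₁ + ℓ₁ := le_add_right h₁.card_pos
  have h := integral_integral_tsum_mul_perronPow (c := pairCoeffStar h₀ H₁ ∅)
    (pairCoeffStar_zero_left h₀ H₁ ∅) (pairCoeffStar_zero_right h₀ H₁ ∅)
    (summable_abs_pairCoeffStar_div h₀ H₁ ∅ hk) hR hA le_rfl
  have hF : ∀ t₁ t₂ : ℝ, FDir₂Star h₀ H₁ ∅ (((1 : ℝ) : ℂ) + t₁ * I) (((1 : ℝ) : ℂ) + t₂ * I) =
      ∑' p : ℕ × ℕ, (pairCoeffStar h₀ H₁ ∅ p.1 p.2 : ℂ) /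
        ((p.1 : ℂ) ^ (((1 : ℝ) : ℂ) + t₁ * I) * (p.2 : ℂ) ^ (((1 : ℝ) : ℂ) + t₂ * I)) :=
    fun _ _ => rfl
  simp_rw [hF]
  rw [h]
  congr 1
  rw [← Complex.ofReal_mul, mainTRTheta_empty_mul_log, Complex.ofReal_sum]
  refine Finset.sum_congr rfl fun de _ => ?_
  push_cast
  ring

end Literature.NumberTheory.Sieve.GPY
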